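import Summits.ValiantsHypothesis.ValiantsHypothesis.Theorems.BarrierLeverDefinableEquationsWeightVector

/-!
# Crux `BarrierLever.DefinableEquations` (stmt-ValiantsHypothesis-8745) / `SingleSizeEquations`
# (8749) — NORMAL FORM, last step: the weight may be taken DOMINANT
# (`w_0 ≥ w_1 ≥ ⋯ ≥ w_{n-1}`, a partition of `n·d` with at most `n` parts)

The crux's class `SmallCircuits ℂ n b` is stable ON THE NOSE under permutations of the variables
(`rename ρ`, `ρ ∈ S_n`: renaming is free in the size measure and keeps the degree), so a weight-vector
equation of weight `(d; w)` may be transported along the induced permutation of the coefficient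
variables to one of weight `(d; w ∘ ρ⁻¹)` (`weightVectorEq_perm`), and sorting makes the weight
non-increasing (`Tuple.sort` composed with `Fin.rev`).  Combined with
`…DefinableEquationsWeightVector.lean`:

THEOREM (`definableEquations_iff_dominantWeightVector`, `singleSizeEquations_iff_dominantWeightVector`).
`DefinableEquations` (resp. `SingleSizeEquations`) holds iff it holds with witnesses whose Boolean
sum is supported on the top coefficients `c_m`, `|m| = n`, and is a torus weight vector of
DOMINANT weight: homogeneous of degree `d`, isobaric of weight `w_i` for the grading `c_m ↦ m_i`,
`w_0 ≥ ⋯ ≥ w_{n-1}`, `Σ_i w_i = n·d` — i.e. a weight vector of `Sym^d(Sym^n ℂ^n)^*` of weight a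
partition `λ ⊢ n d` with `≤ n` parts, the indexing data of the route's plethysm / highest-weight
programme.

Pure bookkeeping (levels and rungs as in `…WeightVector.lean`); no definitions, no named facts.
HONEST FRAMING: a normal form; the crux's open content (Chatterjee–Tengse 2023 §1.3 dir. 2) is
untouched.  References: [ForbesShpilkaVolk2018] Def. 1; [LandsbergGCT2017] §8.
-/

-- layout Summits/ValiantsHypothesis/ValiantsHypothesis forces the duplicated namespace component
set_option linter.dupNamespace false

noncomputable section

open MvPolynomial

namespace Summit.ValiantsHypothesis.ValiantsHypothesis.Theorems.BarrierLever.IsobaricEquations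

open Literature.Computability.AlgebraicComplexity Literature.Barriers.ValiantsHypothesis

variable {n : ℕ}

/-! ## §1 Permuting the variables -/

/-- The permutation of the coefficient variables induced by a permutation `ρ` of `x_0,…,x_{n-1}`:
`m ↦ m ∘ ρ⁻¹` (degrees are preserved). [folklore] -/
theorem degree_equivMapDomain (ρ : Equiv.Perm (Fin n)) (m : Fin n →₀ ℕ) :
    (Finsupp.equivMapDomain ρ m).degree = m.degree := by
  rw [Finsupp.equivMapDomain_eq_mapDomain, Finsupp.degree_mapDomain]

/-- The induced map on `degLEMonomials n`. [folklore] -/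
theorem permMon_mem (ρ : Equiv.Perm (Fin n)) (m : degLEMonomials n) :
    Finsupp.equivMapDomain ρ (m : Fin n →₀ ℕ) ∈ degLEMonomials n := by
  show (Finsupp.equivMapDomain ρ (m : Fin n →₀ ℕ)).degree ≤ n
  rw [degree_equivMapDomain]; exact m.2

/-- The induced map on `degLEMonomials n` is injective. [folklore] -/
theorem permMon_injective (ρ : Equiv.Perm (Fin n)) :
    Function.Injective (fun m : degLEMonomials n =>
      (⟨Finsupp.equivMapDomain ρ (m : Fin n →₀ ℕ), permMon_mem ρ m⟩ : degLEMonomials n)) := by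
  intro m m' h
  apply Subtype.ext
  have h' := congrArg (fun x : degLEMonomials n => Finsupp.equivMapDomain ρ.symm (x : Fin n →₀ ℕ)) h
  simpa [← Finsupp.equivMapDomain_trans] using h'

/-- **Coefficients of a permuted polynomial**: `coeff_{m ∘ ρ⁻¹} (rename ρ f) = coeff_m f`.
[folklore] -/
theorem coeff_rename_perm (ρ : Equiv.Perm (Fin n)) (f : MvPolynomial (Fin n) ℂ) (m : Fin n →₀ ℕ) :
    coeff (Finsupp.equivMapDomain ρ m) (rename ρ f) = coeff m f := by
  rw [Finsupp.equivMapDomain_eq_mapDomain]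
  exact coeff_rename_mapDomain _ ρ.injective _ _

/-- **The crux's class is `S_n`-stable on the nose**: renaming the variables along a permutation
keeps degree and size. [cite: Burgisser2000, Rem. 2.2] -/
theorem rename_perm_mem_smallCircuits (ρ : Equiv.Perm (Fin n)) {b : ℕ} {f : MvPolynomial (Fin n) ℂ}
    (hf : f ∈ SmallCircuits ℂ n b) : rename ρ f ∈ SmallCircuits ℂ n b :=
  ⟨(totalDegree_rename_le _ _).trans hf.1, (complexity_rename_le_holds' _ _).trans hf.2⟩

/-- **Transport of a weight-vector equation along a permutation of the variables** (same `n`, same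
rung, same level): the coordinate weights are permuted, `w ↦ w ∘ ρ⁻¹`; top support, homogeneity and
the weight sum are kept. [folklore] -/
theorem weightVectorEq_perm (ρ : Equiv.Perm (Fin n)) {a b q : ℕ}
    (hq : q ≤ (Nat.choose (2 * n) n) ^ a) (H : MvPolynomial (↥(degLEMonomials n) ⊕ Fin q) ℂ)
    (hc : complexity H ≤ (Nat.choose (2 * n) n) ^ a) (hd : H.totalDegree ≤ (Nat.choose (2 * n) n) ^ a)
    (hne : boolSum H ≠ 0)
    (hvan : ∀ f ∈ SmallCircuits ℂ n b, eval (coeffVector (degLEMonomials n) f) (boolSum H) = 0)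
    (htop : ∀ α ∈ (boolSum H).support, ∀ m ∈ α.support,
      ((m : degLEMonomials n) : Fin n →₀ ℕ).degree = n)
    {d : ℕ} {w : Fin n → ℕ} (hhom : (boolSum H).IsHomogeneous d)
    (hiso : ∀ i : Fin n, IsWeightedHomogeneous
      (fun m : degLEMonomials n => (m : Fin n →₀ ℕ) i) (boolSum H) (w i)) :
    ∃ H' : MvPolynomial (↥(degLEMonomials n) ⊕ Fin q) ℂ, q ≤ (Nat.choose (2 * n) n) ^ a ∧
      complexity H' ≤ (Nat.choose (2 * n) n) ^ a ∧ H'.totalDegree ≤ (Nat.choose (2 * n) n) ^ a ∧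
      boolSum H' ≠ 0 ∧
      (∀ f ∈ SmallCircuits ℂ n b, eval (coeffVector (degLEMonomials n) f) (boolSum H') = 0) ∧
      (∀ α ∈ (boolSum H').support, ∀ m ∈ α.support,
        ((m : degLEMonomials n) : Fin n →₀ ℕ).degree = n) ∧
      (boolSum H').IsHomogeneous d ∧
      ∀ j : Fin n, IsWeightedHomogeneous
        (fun m : degLEMonomials n => (m : Fin n →₀ ℕ) j) (boolSum H') (w (ρ.symm j)) := by
  classical
  -- the induced permutation of the coefficient variables
  let π : degLEMonomials n → degLEMonomials n := fun m =>
    ⟨Finsupp.equivMapDomain ρ (m : Fin n →₀ ℕ), permMon_mem ρ m⟩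
  have hπ : Function.Injective π := permMon_injective ρ
  refine ⟨rename (Sum.map π id) H, hq, (complexity_rename_le_holds' _ _).trans hc,
    (totalDegree_rename_le _ _).trans hd, ?_, ?_, ?_, ?_, ?_⟩
  · rw [boolSum_rename_sumMap]
    exact fun hz => hne (rename_injective _ hπ (by rw [hz, map_zero]))
  · intro f hf
    rw [boolSum_rename_sumMap, eval_rename]
    have hcoe : (coeffVector (degLEMonomials n) f) ∘ π =
        coeffVector (degLEMonomials n) (rename ρ.symm f) := by
      funext m
      simp only [Function.comp_apply, coeffVector_apply, π]
      conv_rhs => rw [← coeff_rename_perm ρ (rename ρ.symm f) (m : Fin n →₀ ℕ), rename_rename]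
      have : (ρ : Fin n → Fin n) ∘ (ρ.symm : Fin n → Fin n) = id := by
        funext i; simp
      rw [this, rename_id, AlgHom.id_apply]
    rw [hcoe]
    exact hvan _ (rename_perm_mem_smallCircuits ρ.symm hf)
  · intro α hα m hm
    rw [boolSum_rename_sumMap, support_rename_of_injective hπ, Finset.mem_image] at hα
    obtain ⟨β, hβ, rfl⟩ := hα
    obtain ⟨m', hm', rfl⟩ := Finset.mem_image.mp (Finsupp.mapDomain_support hm)
    show (Finsupp.equivMapDomain ρ (m' : Fin n →₀ ℕ)).degree = n
    rw [degree_equivMapDomain]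
    exact htop β hβ m' hm'
  · rw [boolSum_rename_sumMap]
    exact hhom.rename_isHomogeneous
  · intro j
    rw [boolSum_rename_sumMap]
    intro α' hα'
    have hmem : α' ∈ (rename π (boolSum H)).support := mem_support_iff.mpr hα'
    rw [support_rename_of_injective hπ, Finset.mem_image] at hmem
    obtain ⟨α, hα, rfl⟩ := hmem
    have hw := hiso (ρ.symm j) (mem_support_iff.mp hα)
    rw [Finsupp.weight_apply, Finsupp.sum_mapDomain_index_inj hπ]
    rw [Finsupp.weight_apply] at hw
    simp only [π, Finsupp.equivMapDomain_apply] at hw ⊢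
    exact hw

/-- **Sorting the weight**: some permutation makes `w ∘ ρ⁻¹` non-increasing. [folklore] -/
theorem exists_perm_antitone (w : Fin n → ℕ) :
    ∃ ρ : Equiv.Perm (Fin n), Antitone (fun j => w (ρ.symm j)) := by
  refine ⟨(Fin.revPerm.trans (Tuple.sort w)).symm, ?_⟩
  intro j j' hjj'
  simp only [Equiv.symm_symm, Equiv.trans_apply, Fin.revPerm_apply]
  exact Tuple.monotone_sort w (Fin.rev_le_rev.mpr hjj')

/-! ## §2 The normal form with dominant weight -/

/-- **`DefinableEquations` in dominant-weight-vector normal form**: WLOG the Boolean-sum witness is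
supported on the top coefficients and is a torus weight vector of DOMINANT weight
(`w_0 ≥ ⋯ ≥ w_{n-1}`, `Σ_i w_i = n·d`). [cite: ForbesShpilkaVolk2018, Def. 1] -/
theorem definableEquations_iff_dominantWeightVector :
    Summit.ValiantsHypothesis.ValiantsHypothesis.Theses.BarrierLever.DefinableEquations ↔
      ∃ a : ℕ, ∀ b : ℕ, ∃ n₀ : ℕ, ∀ n ≥ n₀, ∃ q : ℕ, q ≤ (Nat.choose (2 * n) n) ^ a ∧
        ∃ H : MvPolynomial (↥(degLEMonomials n) ⊕ Fin q) ℂ,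
          complexity H ≤ (Nat.choose (2 * n) n) ^ a ∧ H.totalDegree ≤ (Nat.choose (2 * n) n) ^ a ∧
          boolSum H ≠ 0 ∧
          (∀ f ∈ SmallCircuits ℂ n b, eval (coeffVector (degLEMonomials n) f) (boolSum H) = 0) ∧
          (∀ α ∈ (boolSum H).support, ∀ m ∈ α.support,
            ((m : degLEMonomials n) : Fin n →₀ ℕ).degree = n) ∧
          ∃ (d : ℕ) (w : Fin n → ℕ), (boolSum H).IsHomogeneous d ∧
            (∀ i : Fin n, IsWeightedHomogeneous
              (fun m : degLEMonomials n => (m : Fin n →₀ ℕ) i) (boolSum H) (w i)) ∧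
            ∑ i, w i = n * d ∧ Antitone w := by
  rw [definableEquations_iff_weightVector]
  constructor
  · rintro ⟨a, h⟩
    refine ⟨a, fun b => ?_⟩
    obtain ⟨n₀, hn₀⟩ := h b
    refine ⟨n₀, fun n hn => ?_⟩
    obtain ⟨q, hq, H, hc, hd, hne, hvan, htop, d, w, hhom, hiso, hsum⟩ := hn₀ n hn
    obtain ⟨ρ, hρ⟩ := exists_perm_antitone w
    obtain ⟨H', hq', hc', hd', hne', hvan', htop', hhom', hiso'⟩ :=
      weightVectorEq_perm ρ hq H hc hd hne hvan htop hhom hiso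
    refine ⟨q, hq', H', hc', hd', hne', hvan', htop', d, fun j => w (ρ.symm j), hhom', hiso', ?_, hρ⟩
    rw [← hsum]
    exact Equiv.sum_comp ρ.symm w
  · rintro ⟨a, h⟩
    refine ⟨a, fun b => ?_⟩
    obtain ⟨n₀, hn₀⟩ := h b
    refine ⟨n₀, fun n hn => ?_⟩
    obtain ⟨q, hq, H, hc, hd, hne, hvan, htop, d, w, hhom, hiso, hsum, -⟩ := hn₀ n hn
    exact ⟨q, hq, H, hc, hd, hne, hvan, htop, d, w, hhom, hiso, hsum⟩

/-- **`SingleSizeEquations` in dominant-weight-vector normal form** (stmt-ValiantsHypothesis-8749).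
[cite: ForbesShpilkaVolk2018, Def. 1] -/
theorem singleSizeEquations_iff_dominantWeightVector :
    Summit.ValiantsHypothesis.ValiantsHypothesis.Theses.BarrierLever.SingleSizeEquations ↔
      ∀ b : ℕ, ∃ a n₀ : ℕ, ∀ n ≥ n₀, ∃ q : ℕ, q ≤ (Nat.choose (2 * n) n) ^ a ∧
        ∃ H : MvPolynomial (↥(degLEMonomials n) ⊕ Fin q) ℂ,
          complexity H ≤ (Nat.choose (2 * n) n) ^ a ∧ H.totalDegree ≤ (Nat.choose (2 * n) n) ^ a ∧
          boolSum H ≠ 0 ∧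
          (∀ f ∈ SmallCircuits ℂ n b, eval (coeffVector (degLEMonomials n) f) (boolSum H) = 0) ∧
          (∀ α ∈ (boolSum H).support, ∀ m ∈ α.support,
            ((m : degLEMonomials n) : Fin n →₀ ℕ).degree = n) ∧
          ∃ (d : ℕ) (w : Fin n → ℕ), (boolSum H).IsHomogeneous d ∧
            (∀ i : Fin n, IsWeightedHomogeneous
              (fun m : degLEMonomials n => (m : Fin n →₀ ℕ) i) (boolSum H) (w i)) ∧
            ∑ i, w i = n * d ∧ Antitone w := by
  rw [singleSizeEquations_iff_weightVector]
  constructor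
  · intro h b
    obtain ⟨a, n₀, hn₀⟩ := h b
    refine ⟨a, n₀, fun n hn => ?_⟩
    obtain ⟨q, hq, H, hc, hd, hne, hvan, htop, d, w, hhom, hiso, hsum⟩ := hn₀ n hn
    obtain ⟨ρ, hρ⟩ := exists_perm_antitone w
    obtain ⟨H', hq', hc', hd', hne', hvan', htop', hhom', hiso'⟩ :=
      weightVectorEq_perm ρ hq H hc hd hne hvan htop hhom hiso
    refine ⟨q, hq', H', hc', hd', hne', hvan', htop', d, fun j => w (ρ.symm j), hhom', hiso', ?_, hρ⟩
    rw [← hsum]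
    exact Equiv.sum_comp ρ.symm w
  · intro h b
    obtain ⟨a, n₀, hn₀⟩ := h b
    refine ⟨a, n₀, fun n hn => ?_⟩
    obtain ⟨q, hq, H, hc, hd, hne, hvan, htop, d, w, hhom, hiso, hsum, -⟩ := hn₀ n hn
    exact ⟨q, hq, H, hc, hd, hne, hvan, htop, d, w, hhom, hiso, hsum⟩

end Summit.ValiantsHypothesis.ValiantsHypothesis.Theorems.BarrierLever.IsobaricEquations

end
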